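import Summits.BirchSwinnertonDyer.Rank1Residual.Additive.LocalTorsionAdditiveFiveSeven
import Summits.BirchSwinnertonDyer.Rank1Residual.Additive.QuadraticBranchOddStrictSelmerLevel
import Summits.BirchSwinnertonDyer.Rank1Residual.X11b.Three.GoodReductionSubgroupCuspPadic
import HarnessLib

/-!
# `p ∤ #E(ℚ)_tors` — indeed `E(ℚ_p)[p] = 0` — at every ADDITIVE `p ≥ 5`, except Kodaira II/III at
# `5` with `v₅(c₄) = 1` and Kodaira II at `7` (`v₇(c₆) = 1`); on the (G)-cell: except III@5, II@7

HONEST FRAMING (cell `b2b-bsdres`, run/shared/lean/b2b/bsd-rank1-residual/, verbatim in every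
file): the goal of the cell is to DELETE the COMBINATION-SHAPED residual classes of the
Birch–Swinnerton-Dyer formula for ALL analytic-rank `≤ 1` elliptic curves over `ℚ` — "full BSD
formula for every rank `≤ 1` curve in class `C`" assembled STRICTLY from published theorems — so
that the rank-`≤ 1` remainder becomes exactly the CONSTRUCTION-SHAPED classes, which are TYPED
(missing-input `Prop`s), NOT attempted. This is not "finishing BSD". Sub-cell `additive-p2`
(X3♯(G-ord) / X4♯(G-ord)), generation 37: research route; no claim beyond the stated classes;
theorems only, no definition, no named fact, nothing booked, no label moved.

## What and why

Every leading-term statement of the cell at an additive prime `p` carries the term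
`2·ord_p #E(ℚ)_tors` (`t`; Delbourgo 2002 (B) clause 3, the squeeze / full-squeeze / analytic-Ш
laws of gens 29–33, n1011-p05's `LocalTorsionExponent` with `t ≤ 1`).  On class X4 (`E[p]`
irreducible) `t = 0` trivially; gen 11 (`GordTorsionFree`) proved `E(F)[p] = 0` even over the
(G)-fields and recorded that on X3 (reducible `E[p]`) "the statement is false in general".  This
file settles X3 — and every additive class — over `ℚ` and over `ℚ_p`, from the local theorem
`CuspTorsion.norm_c₄_or_norm_c₆_of_prime_zsmul_eq_zero` (`Additive/LocalTorsionAdditiveFiveSeven`,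
Mazur's Step 1 at `q = N` pushed down to `N ∈ {5, 7}`):

* **`padicValRat_c₄_or_c₆_of_prime_zsmul_eq_zero_of_addv`** — `W/ℚ` globally minimal, `p ≥ 5`,
  `Addv W p`, `P ∈ E(ℚ_p)`, `P ≠ O`, `p • P = O` ⟹ `(p = 5 ∧ v₅(c₄) = 1) ∨ (p = 7 ∧ v₇(c₆) = 1)`;
* **`eq_zero_of_prime_zsmul_eq_zero_of_addv`** (`E(ℚ_p)[p] = 0` off that locus; `p ≥ 11`: no side
  condition), `…_rat` (`E(ℚ)[p] = 0`), **`not_dvd_torsionOrder_of_addv`** /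
  **`padicValNat_torsionOrder_eq_zero_of_addv`** (`p ∤ #E(ℚ)_tors`, i.e. `t = 0`),
  `padicValNat_card_torsion_padic_eq_zero_of_addv` (n1011-p05's local `t = 0`);
* the DICTIONARY with the Kodaira type (`Additive/GordKodairaType`, Ogg at an additive `p ≥ 5`):
  `v₅(c₄) = 1 ⟹ v₅(Δ_min) ∈ {2, 3}` (II or III), `v₇(c₆) = 1 ⟹ v₇(Δ_min) = 2` (II), so
  **`kodairaSymbolAt_of_prime_zsmul_eq_zero_of_addv`**: `p`-torsion in `E(ℚ_p)` at an additive
  `p ≥ 5` ⟹ `(p = 5 ∧ type ∈ {II, III}) ∨ (p = 7 ∧ type = II)` — in particular NEVER on a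
  starred type, never on `I₀*`/`Iₙ*`, never on IV/IV*, never at `p ≥ 11`;
* the (G)-CELL (`TypeG W p`, `e ∣ p − 1`): at `5` only `e ∣ 4` occurs, so
  **`TypeG.padicValInt_of_prime_zsmul_eq_zero`**: `p`-torsion ⟹ `(p = 5 ∧ v₅(Δ_min) = 3)` (III,
  `e = 4`) `∨ (p = 7 ∧ v₇(Δ_min) = 2)` (II, `e = 6`), and
  **`ClassX3Gord.padicValNat_torsionOrder_eq_zero` / `ClassX4Gord.…`**: `t = 0` on
  X3♯(G-ord)/X4♯(G-ord) away from {III@5, II@7}.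

Both exceptions are realised over `ℚ` inside X3♯(G-ord) ∩ … : `y² − 2xy − 3y = x³ − 3x²`
(`X₁(5)`, `t = 3`; type II at `5`, NOT (G) since `6 ∤ 4`) shows the `c₄`-condition is sharp at `5`,
and `[1, −1, 1, …]`-free example `a = [−19, −100, −100, 0, 0]` (`X₁(7)`, `d = 5`, conductor
`490 = 2·5·7²`, type II at `7`, `e = 6 ∣ 6`: a (G)-ordinary pair at `7` WITH a rational `7`-torsion
point) shows the (G)-cell statement is sharp at `7`.

References: [Mazur1977] Ch. III §5, Step 1, p. 158; [SilvermanAEC2009] VII.3.1, VII.3.4,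
Exercise 3.7; [SilvermanATAEC1994] IV Table 4.1, Cor. IV.9.2(d); M. Flexor – J. Oesterlé,
Astérisque 183 (1990) 25–36 (context).
-/

noncomputable section

open scoped Classical

namespace Summit.BirchSwinnertonDyer.Rank1Residual.Additive

open WeierstrassCurve Literature.NumberTheory.EllipticCurves
  Literature.NumberTheory.EllipticCurves.Rank1Residual

/-! ## §1 `p`-adic norms of rationals vs `padicValRat` -/

section NormVal

variable {p : ℕ} [hp : Fact p.Prime]

/-- `‖q‖_p = p⁻¹ ⟺ v_p(q) = 1` (for `q = 0` both sides fail); `‖q‖_p = p^{−v_p(q)}` for `q ≠ 0`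
is Mathlib's `Padic.eq_padicNorm` + `padicNorm.eq_zpow_of_nonzero` (also in the tree as
`Literature.NumberTheory.Automorphic.Padic.norm_ratCast_eq_zpow`, not imported here). [folklore] -/
theorem CuspTorsion.norm_ratCast_eq_inv_iff (q : ℚ) :
    ‖(q : ℚ_[p])‖ = (p : ℝ)⁻¹ ↔ padicValRat p q = 1 := by
  have hp1 : (1 : ℝ) < p := by exact_mod_cast hp.out.one_lt
  by_cases hq : q = 0
  · subst hq
    simp only [Rat.cast_zero, norm_zero, padicValRat.zero, zero_ne_one, iff_false]
    exact (ne_of_lt (by positivity))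
  have e : ‖(q : ℚ_[p])‖ = (p : ℝ) ^ (-padicValRat p q) := by
    rw [Padic.eq_padicNorm, padicNorm.eq_zpow_of_nonzero hq]; push_cast; rfl
  rw [e, ← zpow_neg_one]
  constructor
  · intro h
    have := zpow_right_injective₀ (by positivity) hp1.ne' h
    omega
  · intro h
    rw [h]

/-- `‖q‖_p < 1 ⟺ 1 ≤ v_p(q)` for `q ∈ ℚ^×`. [folklore] -/
theorem CuspTorsion.norm_ratCast_lt_one_iff {q : ℚ} (hq : q ≠ 0) :
    ‖(q : ℚ_[p])‖ < 1 ↔ 1 ≤ padicValRat p q := by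
  have hp1 : (1 : ℝ) < p := by exact_mod_cast hp.out.one_lt
  have e : ‖(q : ℚ_[p])‖ = (p : ℝ) ^ (-padicValRat p q) := by
    rw [Padic.eq_padicNorm, padicNorm.eq_zpow_of_nonzero hq]; push_cast; rfl
  rw [e, ← zpow_zero (p : ℝ), zpow_lt_zpow_iff_right₀ hp1]
  omega

end NormVal

/-! ## §2 The exceptional locus for `E/ℚ` at an additive `p ≥ 5` -/

section Rat

variable (W : WeierstrassCurve ℚ) [W.IsElliptic] [W.IsGloballyMinimal] (p : ℕ) [hp : Fact p.Prime]

omit [W.IsElliptic] [W.IsGloballyMinimal] in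
/-- `c₄(E ⊗ ℚ_p) = c₄(E)`. [folklore] -/
theorem baseChange_padic_c₄ : (W.baseChange ℚ_[p]).c₄ = (W.c₄ : ℚ_[p]) :=
  (map_c₄ W (algebraMap ℚ ℚ_[p])).trans (eq_ratCast _ _)

omit [W.IsElliptic] [W.IsGloballyMinimal] in
/-- `c₆(E ⊗ ℚ_p) = c₆(E)`. [folklore] -/
theorem baseChange_padic_c₆ : (W.baseChange ℚ_[p]).c₆ = (W.c₆ : ℚ_[p]) :=
  (map_c₆ W (algebraMap ℚ ℚ_[p])).trans (eq_ratCast _ _)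

/-- **At an additive prime of a globally minimal model, `p ∣ c₄`, `p ∣ c₆`** (as `v_p ≥ 1` or the
invariant vanishes). [cite: SilvermanAEC2009, VII.5 Prop. 5.1] -/
theorem padicValRat_c₄_c₆_of_addv (hadd : Addv W p) :
    (W.c₄ = 0 ∨ 1 ≤ padicValRat p W.c₄) ∧ (W.c₆ = 0 ∨ 1 ≤ padicValRat p W.c₆) := by
  haveI := X11b.Three.JetchevKummer.hasAdditiveReduction_baseChange_padic_of_not_good_of_not_mult
    W p hadd.1 hadd.2
  obtain ⟨h4, h6, -⟩ := CuspTorsion.norm_c₄_c₆_Δ_lt_one (W.baseChange ℚ_[p])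
  rw [baseChange_padic_c₄] at h4
  rw [baseChange_padic_c₆] at h6
  refine ⟨?_, ?_⟩
  · by_cases h0 : W.c₄ = 0
    · exact Or.inl h0
    · exact Or.inr ((CuspTorsion.norm_ratCast_lt_one_iff h0).mp h4)
  · by_cases h0 : W.c₆ = 0
    · exact Or.inl h0
    · exact Or.inr ((CuspTorsion.norm_ratCast_lt_one_iff h0).mp h6)

/-- **The exceptional locus for `E/ℚ`**: `W` globally minimal, `p ≥ 5` additive, `P ∈ E(ℚ_p)`,
`P ≠ O`, `p • P = O` ⟹ `(p = 5 ∧ v₅(c₄) = 1)` (Kodaira II/III) `∨ (p = 7 ∧ v₇(c₆) = 1)` (Kodaira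
II). [cite: Mazur1977, Ch. III §5, Step 1, p. 158] -/
theorem padicValRat_c₄_or_c₆_of_prime_zsmul_eq_zero_of_addv (hp5 : 5 ≤ p) (hadd : Addv W p)
    {P : (W.baseChange ℚ_[p]).toAffine.Point} (hP0 : P ≠ 0) (hP : (p : ℤ) • P = 0) :
    (p = 5 ∧ padicValRat p W.c₄ = 1) ∨ (p = 7 ∧ padicValRat p W.c₆ = 1) := by
  haveI := X11b.Three.JetchevKummer.hasAdditiveReduction_baseChange_padic_of_not_good_of_not_mult
    W p hadd.1 hadd.2
  haveI : (W.baseChange ℚ_[p]).IsElliptic := by rw [baseChange]; infer_instance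
  rcases CuspTorsion.norm_c₄_or_norm_c₆_of_prime_zsmul_eq_zero hp5 (W.baseChange ℚ_[p]) hP0 hP
    with ⟨h5, hn⟩ | ⟨h7, hn⟩
  · rw [baseChange_padic_c₄, CuspTorsion.norm_ratCast_eq_inv_iff] at hn
    exact Or.inl ⟨h5, hn⟩
  · rw [baseChange_padic_c₆, CuspTorsion.norm_ratCast_eq_inv_iff] at hn
    exact Or.inr ⟨h7, hn⟩

/-- **`E(ℚ_p)[p] = 0` at an additive `p ≥ 5` off the exceptional locus** (no side condition for
`p ≥ 11`; at `5`: `v₅(c₄) ≠ 1`; at `7`: `v₇(c₆) ≠ 1`). [cite: Mazur1977, Ch. III §5, Step 1, p. 158] -/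
theorem eq_zero_of_prime_zsmul_eq_zero_of_addv (hp5 : 5 ≤ p) (hadd : Addv W p)
    (h5 : p = 5 → padicValRat p W.c₄ ≠ 1) (h7 : p = 7 → padicValRat p W.c₆ ≠ 1)
    {P : (W.baseChange ℚ_[p]).toAffine.Point} (hP : (p : ℤ) • P = 0) : P = 0 := by
  by_contra hP0
  rcases padicValRat_c₄_or_c₆_of_prime_zsmul_eq_zero_of_addv W p hp5 hadd hP0 hP with
    ⟨h, hv⟩ | ⟨h, hv⟩
  · exact h5 h hv
  · exact h7 h hv

/-- The same with `ℕ`-scalars: `p • P = O ⟹ P = O` in `E(ℚ_p)`. [cite: Mazur1977, Ch. III §5, Step 1, p. 158] -/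
theorem eq_zero_of_prime_nsmul_eq_zero_of_addv (hp5 : 5 ≤ p) (hadd : Addv W p)
    (h5 : p = 5 → padicValRat p W.c₄ ≠ 1) (h7 : p = 7 → padicValRat p W.c₆ ≠ 1)
    {P : (W.baseChange ℚ_[p]).toAffine.Point} (hP : p • P = 0) : P = 0 :=
  eq_zero_of_prime_zsmul_eq_zero_of_addv W p hp5 hadd h5 h7 (by rw [natCast_zsmul]; exact hP)

/-- At `p ≥ 11` no side condition: **`E(ℚ_p)[p] = 0` at every additive `p ≥ 11`** (the tree's
`not_prime_zsmul_eq_zero_of_hasAdditiveReduction`, in the cell's `Addv` currency).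
[cite: Mazur1977, Ch. III §5, Step 1, p. 158] -/
theorem eq_zero_of_prime_nsmul_eq_zero_of_addv_of_eleven_le (h11 : 11 ≤ p) (hadd : Addv W p)
    {P : (W.baseChange ℚ_[p]).toAffine.Point} (hP : p • P = 0) : P = 0 :=
  eq_zero_of_prime_nsmul_eq_zero_of_addv W p (by omega) hadd (fun h => by omega)
    (fun h => by omega) hP

/-- **`E(ℚ)[p] = 0`** at an additive `p ≥ 5` off the exceptional locus (`E(ℚ) ↪ E(ℚ_p)`).
[cite: Mazur1977, Ch. III §5, Step 1, p. 158] -/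
theorem eq_zero_of_prime_zsmul_eq_zero_of_addv_rat (hp5 : 5 ≤ p) (hadd : Addv W p)
    (h5 : p = 5 → padicValRat p W.c₄ ≠ 1) (h7 : p = 7 → padicValRat p W.c₆ ≠ 1)
    {P : W.toAffine.Point} (hP : (p : ℤ) • P = 0) : P = 0 := by
  have hinj : Function.Injective (W.toPadicPoint p) :=
    Affine.Point.map_injective (W' := W) (Algebra.ofId ℚ ℚ_[p])
  apply hinj
  rw [map_zero]
  exact eq_zero_of_prime_zsmul_eq_zero_of_addv W p hp5 hadd h5 h7 (by rw [← map_zsmul, hP, map_zero])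

/-- **`p ∤ #E(ℚ)_tors`** at an additive `p ≥ 5` off the exceptional locus.
[cite: Mazur1977, Ch. III §5, Step 1, p. 158] -/
theorem not_dvd_torsionOrder_of_addv (hp5 : 5 ≤ p) (hadd : Addv W p)
    (h5 : p = 5 → padicValRat p W.c₄ ≠ 1) (h7 : p = 7 → padicValRat p W.c₆ ≠ 1) :
    ¬ p ∣ W.torsionOrder :=
  not_dvd_torsionOrder_of_noPTorsion W p
    (fun _ hQ => eq_zero_of_prime_nsmul_eq_zero_of_addv W p hp5 hadd h5 h7 hQ)

/-- **`t = ord_p #E(ℚ)_tors = 0`** at an additive `p ≥ 5` off the exceptional locus — the term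
`2·ord_p #E(ℚ)_tors` of every leading-term identity of the cell vanishes there.
[cite: Mazur1977, Ch. III §5, Step 1, p. 158] -/
theorem padicValNat_torsionOrder_eq_zero_of_addv (hp5 : 5 ≤ p) (hadd : Addv W p)
    (h5 : p = 5 → padicValRat p W.c₄ ≠ 1) (h7 : p = 7 → padicValRat p W.c₆ ≠ 1) :
    padicValNat p W.torsionOrder = 0 :=
  padicValNat.eq_zero_of_not_dvd (not_dvd_torsionOrder_of_addv W p hp5 hadd h5 h7)

/-- `t = 0` at every additive `p ≥ 11`, unconditionally. [cite: Mazur1977, Ch. III §5, Step 1, p. 158] -/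
theorem padicValNat_torsionOrder_eq_zero_of_addv_of_eleven_le (h11 : 11 ≤ p) (hadd : Addv W p) :
    padicValNat p W.torsionOrder = 0 :=
  padicValNat_torsionOrder_eq_zero_of_addv W p (by omega) hadd (fun h => by omega) (fun h => by omega)

/-- **The local exponent vanishes too: `ord_p #E(ℚ_p)_tors = 0`** at an additive `p ≥ 5` off the
exceptional locus (n1011-p05's `t ≤ 1` of `Additive/LocalTorsionExponent`, sharpened to `0` and
freed of `p ∤ c_p`; if the torsion subgroup were infinite `Nat.card = 0` and the value is `0`
trivially). [cite: SilvermanAEC2009, VII.3 Prop. 3.1] -/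
theorem padicValNat_card_torsion_padic_eq_zero_of_addv (hp5 : 5 ≤ p) (hadd : Addv W p)
    (h5 : p = 5 → padicValRat p W.c₄ ≠ 1) (h7 : p = 7 → padicValRat p W.c₆ ≠ 1) :
    padicValNat p (Nat.card (AddCommGroup.torsion (W.baseChange ℚ_[p]).toAffine.Point)) = 0 := by
  by_cases hfin : Finite (AddCommGroup.torsion (W.baseChange ℚ_[p]).toAffine.Point)
  · refine padicValNat.eq_zero_of_not_dvd fun hdvd => ?_
    obtain ⟨T, hT⟩ := exists_prime_addOrderOf_dvd_card' (G := AddCommGroup.torsion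
      (W.baseChange ℚ_[p]).toAffine.Point) p hdvd
    have hpT : p • (T : (W.baseChange ℚ_[p]).toAffine.Point) = 0 := by
      have h := addOrderOf_nsmul_eq_zero T
      rw [hT] at h
      exact_mod_cast congrArg Subtype.val h
    have hT0 : (T : (W.baseChange ℚ_[p]).toAffine.Point) = 0 :=
      eq_zero_of_prime_nsmul_eq_zero_of_addv W p hp5 hadd h5 h7 hpT
    have hT1 : addOrderOf T = 1 := by
      rw [show T = 0 from Subtype.ext hT0, addOrderOf_zero]
    rw [hT1] at hT
    exact hp.out.one_lt.ne' hT.symm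
  · haveI := not_finite_iff_infinite.mp hfin
    rw [Nat.card_eq_zero_of_infinite]
    simp

end Rat

end Summit.BirchSwinnertonDyer.Rank1Residual.Additive

end
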